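import Literature.MathematicalPhysics.QuantumLattice.HubbardRingDecaySharp
import HarnessLib
import HarnessLib.Audit

/-!
# Hubbard ladder — Bounds: exponential clustering of EVERY `n`-fermion correlation on the
# one-dimensional Hubbard ring at all temperatures, explicit correlation length
# `ξ_n ≤ 16|t|/(n²T)` for `T ≤ 8|t|/n` (bounds.tex Thm 10⁶; Koma–Tasaki's 1D clause made explicit)

HONEST FRAMING (cell pub-hubbard): ladder R1–R4 with certified numbers; no claim on H/H₀. These
are bounds for a MODEL CLASS — the grand-canonical Hubbard model `hubbardTorusWith 1 L t U μ` on
the ring `ℤ/Lℤ` (every `L ≥ 1`, all real `t, U, μ`, every `β ≥ 0`); no materials claim.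
Companion text: `pub-hubbard/paper/bounds.tex` §Theorem 10 (Thm 10⁶); tables
`pub-hubbard/pub-hubbard-bounds/BOUNDS.md` (row T8¹¹) and `EXTREMISERS.md` §5m.

## Relation to what the tree already proves (read this first)

For the ON-SITE `s`-wave pair (`n = 2`, `P_x = c_{x↑}c_{x↓}`) the qualitative one-dimensional
clause is ALREADY a theorem of the tree: `koma_tasaki_1d_holds`
(`HubbardHubbardModelKomaTasakiProofs`) gives, for all `t, U, μ`, `β > 0`, uniformly in `L`,
`|⟨Δ_x† Δ_y⟩_{β,L}| ≤ 1 · exp(-dist(x,y)/(16β|t| + 1))` (prefactor `1`, rate `1/(16β|t|+1)`; linear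
profile `exists_testFunction_one`, charge `≤ 1`, operator-norm a priori bound), and
`koma_tasaki_magnetic_holds` the same for `⟨S⁺_x S⁻_y⟩`. What is NEW here: (i) SCOPE — every
`n`-fermion local product (`n = 1`: the one-particle Green's function; `n = 2`: triplet and
nearest-neighbour bond pairs and pair-hopping correlators, not only the on-site singlet; `n = 4`:
quartets; any spins), for which the tree had no one-dimensional statement; (ii) RATES — the
free-charge family below with Koma–Tasaki's printed hopping norm, whose low-temperature rate
`n²/(16β|t|)` is, for `n = 2`, `1/(4β|t|) ≥ 4 × 1/(16β|t|+1)` (four times the tree's), at the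
price of the prefactor `e^{n²/(4β|t|)} ≤ e^{2n}` instead of `1` — for the on-site pair the new
bound is the sharper one at every distance `≥ 6` and every `T ≤ 4|t|` (crossover
`4(16b+1)/(12b+1) < 16/3`, `b = β|t|`), the tree's at distances `≤ 5`; both hold.

## Content

Koma–Tasaki, PRL 68 (1992) 3248, Theorem, last clause: in one dimension the bounds (2)–(4) hold
with right-hand sides `2 exp[-γ f(β)|x-y|]`, …, `f(β) ≈ 1/β` at low temperature — constants not
printed. The new Literature file `HubbardRingDecaySharp` (this seat) makes the clause explicit,
in the generality of footnote [10]: for `P_x = c_{x+δ₁,σ₁} ⋯ c_{x+δ_n,σ_n}` (`δ_i ∈ {0, ±1}`, any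
spins) and any `P'_y` of the same length, every `q ≥ 0`, uniformly in `L`, all `U`, `μ`,
`|⟨(P_x)† P'_y⟩_{β,L}| ≤ e^{2nq} exp(-[nq - 4β|t|(cosh q - 1)] dist(x,y))`
(`norm_thermalCorr_multiFermion_ring_le_exp`; the test function is the clamped cone
`-q·clamp(dist(·,x); 1, dist(x,y)-1)`, whose bond energy on the ring is `≤ 4R(cosh q - 1)`).
Proved here (ladder nodes):

* `RingExponentialClustering` / `_holds` — for every `n ≥ 1`, all real `t, U, μ`, `β ≥ 0` there
  are `m > 0` and `C` with `|⟨(P_x)† P'_y⟩_{β,L}| ≤ C e^{-m dist(x,y)}` for ALL `L, x, y` (no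
  `n`-electron order of any kind on the ring at any temperature, uniformly in the size);
* `RingCorrelationLengthLowT` / `_holds` — the explicit rate: if `T ≤ 8|t|/n` then
  `|⟨(P_x)† P'_y⟩_{β,L}| ≤ e^{n²/(4β|t|)} exp(-n² T dist(x,y)/(16|t|))`, i.e. the `n`-fermion
  correlation length obeys `ξ_n(T) ≤ 16|t|/(n² T)`: `16|t|/T` for the one-particle Green's
  function, `4|t|/T` for every pair field, `|t|/T` for quartets;
* `RingCorrelationLengthHighT` / `_holds` — if `T ≥ 8|t|/n`: `≤ e^{2n} exp(-(n/2) dist(x,y))`;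
* `onSitePair_ring_decay`, `green_ring_decay` — the named instances `n = 2` (`c_{x↑}c_{x↓}`) and
  `n = 1` (`c_{xσ}`).

Reading (bounds.tex Thm 10⁶): the one-dimensional Hubbard ring has, at every temperature
`T > 0`, exponentially clustering `n`-fermion correlations with a correlation length bounded by
`16|t|/(n²T)` at low `T`, whatever `U` and the filling — an explicit, machine-checked form of
Koma–Tasaki's `γ f(β) ∝ 1/β`; the factor `4` (two arcs of the ring, two spin species per bond)
is what makes the statement uniform in `L`; NOT claimed: optimality (free fermions have
`ξ₁ = v_F/(πT) ≤ 2|t|/(πT)`, so the true inverse length is `≥ πT/(2|t|)`, a factor `8π` above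
our `T/(16|t|)` for `n = 1`); any lower bound on correlations; longer-range hopping.

References (keys of `lean/references.bib`): KomaTasakiPRL1992 (Theorem, one-dimensional clause;
eqs. (5)–(13); note 9: `γ = δ = 1/t`; footnote [10]); McBryanSpencer1977. Tree predecessors
(`n = 2` on-site, spins): `koma_tasaki_1d_holds`, `koma_tasaki_magnetic_holds`,
`le_exp_of_forall_testFunction_one`, `exists_testFunction_one`. Context: H. Araki,
Commun. Math. Phys. 14 (1969) 120 (analyticity and clustering of one-dimensional quantum lattice
systems at all temperatures; non-explicit, interaction-dependent constants).
-/

noncomputable section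

namespace Summit.HubbardSuperconductivity.HubbardLadder.Bounds

open Matrix Finset NormedSpace
open Literature.MathematicalPhysics.QuantumLattice Literature.Probability.LatticeModels

open scoped Matrix.Norms.L2Operator ComplexOrder

/-! ### Exponential clustering at every temperature, uniformly in `L` -/

/-- **Thm 10⁶ (qualitative form; PROVED below).** On the Hubbard ring `ℤ/Lℤ` with Hamiltonian
`H(t,U) - μN`, for every `n ≥ 1`, steps `δ_i, δ'_i ∈ {0, ±1}`, arbitrary spins, all real
`t, U, μ` and every `β ≥ 0` there are `m > 0` and `C` such that
`|⟨(P_x)† P'_y⟩_{β,L}| ≤ C e^{-m dist(x,y)}` for ALL `L ≥ 1` and all sites `x, y`.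
kind: support (PROVED). Why it might fail: it cannot (proved). Sources: KomaTasakiPRL1992
Theorem (one-dimensional clause), footnote [10]; this cell bounds.tex Thm 10⁶. -/
@[conjecture] def RingExponentialClustering : Prop :=
  ∀ (n : ℕ) (δ δ' : Fin n → Site 1) (σ σ' : Fin n → Fin 2),
    (∀ i j, δ i j = 0 ∨ δ i j = 1 ∨ δ i j = -1) → (∀ i j, δ' i j = 0 ∨ δ' i j = 1 ∨ δ' i j = -1) →
    0 < n → ∀ (t U μ β : ℝ), 0 ≤ β →
    ∃ m C : ℝ, 0 < m ∧ ∀ (L : ℕ) [NeZero L] (x y : TorusSite 1 L),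
      ‖(hubbardTorusWith 1 L t U μ).thermalCorr β
          (multiFermionD 1 δ σ L x)ᴴ (multiFermionD 1 δ' σ' L y)‖ ≤
        C * Real.exp (-(m * (torusDist x y : ℝ)))

/-- **`RingExponentialClustering` holds**: `m = n²/(16β|t|)` if `n ≤ 8β|t|`
(`norm_thermalCorr_multiFermion_ring_le_exp_lowT`), else `m = n/2`
(`norm_thermalCorr_multiFermion_ring_le_exp_highT`). -/
theorem ringExponentialClustering_holds : RingExponentialClustering := by
  intro n δ δ' σ σ' hδ hδ' hn t U μ β hβ
  have hn' : (0 : ℝ) < n := by exact_mod_cast hn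
  rcases le_or_gt (n : ℝ) (8 * (β * |t|)) with hlow | hhigh
  · have hb : 0 < β * |t| := by linarith
    refine ⟨(n : ℝ) ^ 2 / (16 * (β * |t|)), Real.exp ((n : ℝ) ^ 2 / (4 * (β * |t|))),
      by positivity, fun L _ x y => ?_⟩
    have h := norm_thermalCorr_multiFermion_ring_le_exp_lowT L δ δ' σ σ' hδ hδ' t U μ β hβ hlow x y
    simpa [neg_mul] using h
  · refine ⟨(n : ℝ) / 2, Real.exp (2 * n), by positivity, fun L _ x y => ?_⟩
    have h := norm_thermalCorr_multiFermion_ring_le_exp_highT L δ δ' σ σ' hδ hδ' t U μ β hβ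
      hhigh.le x y
    simpa [neg_mul] using h

/-! ### The explicit correlation length -/

/-- **Thm 10⁶ (explicit low-temperature rate; PROVED below).** On the Hubbard ring, for every
`n`, steps in `{0, ±1}`, arbitrary spins, all real `t, U, μ`, `β ≥ 0` with `n ≤ 8β|t|`
(temperature `T ≤ 8|t|/n`), uniformly in `L`:
`|⟨(P_x)† P'_y⟩_{β,L}| ≤ e^{n²/(4β|t|)} exp(-n² dist(x,y)/(16β|t|))` — the `n`-fermion
correlation length is at most `16β|t|/n² = 16|t|/(n²T)`. kind: support (PROVED).
Why it might fail: it cannot (proved); NOT claimed: optimality (free fermions: factor `8π`).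
Sources: KomaTasakiPRL1992 Theorem (one-dimensional clause), eq. (13), note 9, footnote [10];
McBryanSpencer1977; this cell bounds.tex Thm 10⁶. -/
@[conjecture] def RingCorrelationLengthLowT : Prop :=
  ∀ (n : ℕ) (δ δ' : Fin n → Site 1) (σ σ' : Fin n → Fin 2),
    (∀ i j, δ i j = 0 ∨ δ i j = 1 ∨ δ i j = -1) → (∀ i j, δ' i j = 0 ∨ δ' i j = 1 ∨ δ' i j = -1) →
    ∀ (t U μ β : ℝ), 0 ≤ β → (n : ℝ) ≤ 8 * (β * |t|) →
    ∀ (L : ℕ) [NeZero L] (x y : TorusSite 1 L),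
      ‖(hubbardTorusWith 1 L t U μ).thermalCorr β
          (multiFermionD 1 δ σ L x)ᴴ (multiFermionD 1 δ' σ' L y)‖ ≤
        Real.exp ((n : ℝ) ^ 2 / (4 * (β * |t|))) *
          Real.exp (-((n : ℝ) ^ 2 / (16 * (β * |t|)) * (torusDist x y : ℝ)))

/-- **`RingCorrelationLengthLowT` holds** (`norm_thermalCorr_multiFermion_ring_le_exp_lowT`). -/
theorem ringCorrelationLengthLowT_holds : RingCorrelationLengthLowT :=
  fun _ δ δ' σ σ' hδ hδ' t U μ β hβ hn L _ x y =>
    norm_thermalCorr_multiFermion_ring_le_exp_lowT L δ δ' σ σ' hδ hδ' t U μ β hβ hn x y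

/-- **Thm 10⁶ (high temperatures; PROVED below).** If `8β|t| ≤ n` (`T ≥ 8|t|/n`) then, uniformly
in `L`, `|⟨(P_x)† P'_y⟩_{β,L}| ≤ e^{2n} exp(-(n/2) dist(x,y))`. kind: support (PROVED).
Why it might fail: it cannot (proved). Sources: KomaTasakiPRL1992 Theorem (one-dimensional
clause); this cell bounds.tex Thm 10⁶. -/
@[conjecture] def RingCorrelationLengthHighT : Prop :=
  ∀ (n : ℕ) (δ δ' : Fin n → Site 1) (σ σ' : Fin n → Fin 2),
    (∀ i j, δ i j = 0 ∨ δ i j = 1 ∨ δ i j = -1) → (∀ i j, δ' i j = 0 ∨ δ' i j = 1 ∨ δ' i j = -1) →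
    ∀ (t U μ β : ℝ), 0 ≤ β → 8 * (β * |t|) ≤ n →
    ∀ (L : ℕ) [NeZero L] (x y : TorusSite 1 L),
      ‖(hubbardTorusWith 1 L t U μ).thermalCorr β
          (multiFermionD 1 δ σ L x)ᴴ (multiFermionD 1 δ' σ' L y)‖ ≤
        Real.exp (2 * n) * Real.exp (-((n : ℝ) / 2 * (torusDist x y : ℝ)))

/-- **`RingCorrelationLengthHighT` holds** (`norm_thermalCorr_multiFermion_ring_le_exp_highT`). -/
theorem ringCorrelationLengthHighT_holds : RingCorrelationLengthHighT :=
  fun _ δ δ' σ σ' hδ hδ' t U μ β hβ hn L _ x y =>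
    norm_thermalCorr_multiFermion_ring_le_exp_highT L δ δ' σ σ' hδ hδ' t U μ β hβ hn x y

/-! ### Named instances: the on-site pair field and the one-particle Green's function -/

/-- The zero step `0 ∈ ℤ¹` has coordinates in `{0, 1, -1}`. -/
theorem zeroSteps_mem {n : ℕ} (i : Fin n) (j : Fin 1) :
    (fun _ : Fin n => (0 : Site 1)) i j = 0 ∨ (fun _ : Fin n => (0 : Site 1)) i j = 1 ∨
      (fun _ : Fin n => (0 : Site 1)) i j = -1 := Or.inl rfl

/-- The on-site pair spins `(↑, ↓)`. -/
def pairSpins : Fin 2 → Fin 2 := ![0, 1]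

/-- **On-site `s`-wave pairs on the ring** (`P_x = c_{x↑} c_{x↓}`, `n = 2`; the tree's
`koma_tasaki_1d_holds` gives the same correlator `≤ exp(-dist/(16β|t|+1))` — rate four times
smaller, prefactor `1`; this instance is the sharper bound at every distance `≥ 6`): for `T ≤ 4|t|`,
uniformly in `L`, all `U`, `μ`: `|⟨P_x† P_y⟩_{β,L}| ≤ e^{1/(β|t|)} exp(-T dist(x,y)/(4|t|))` —
pair correlation length `≤ 4|t|/T`. -/
theorem onSitePair_ring_decay (t U μ β : ℝ) (hβ : 0 ≤ β) (hT : (2 : ℝ) ≤ 8 * (β * |t|))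
    (L : ℕ) [NeZero L] (x y : TorusSite 1 L) :
    ‖(hubbardTorusWith 1 L t U μ).thermalCorr β
        (multiFermionD 1 (fun _ : Fin 2 => (0 : Site 1)) pairSpins L x)ᴴ
        (multiFermionD 1 (fun _ : Fin 2 => (0 : Site 1)) pairSpins L y)‖ ≤
      Real.exp (1 / (β * |t|)) * Real.exp (-(1 / (4 * (β * |t|)) * (torusDist x y : ℝ))) := by
  have h := ringCorrelationLengthLowT_holds 2 (fun _ => 0) (fun _ => 0) pairSpins pairSpins
    zeroSteps_mem zeroSteps_mem t U μ β hβ (by exact_mod_cast hT) L x y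
  have h1 : ((2 : ℕ) : ℝ) ^ 2 / (4 * (β * |t|)) = 1 / (β * |t|) := by
    have hb : β * |t| ≠ 0 := by intro h0; rw [h0] at hT; norm_num at hT
    push_cast; field_simp; ring
  have h2 : ((2 : ℕ) : ℝ) ^ 2 / (16 * (β * |t|)) = 1 / (4 * (β * |t|)) := by
    have hb : β * |t| ≠ 0 := by intro h0; rw [h0] at hT; norm_num at hT
    push_cast; field_simp; ring
  rw [h1, h2] at h
  exact h

/-- **The one-particle Green's function on the ring** (`c_{xσ}`, `n = 1`): for `T ≤ 8|t|`,
uniformly in `L`, all `U`, `μ`: `|⟨c†_{xσ} c_{yσ'}⟩_{β,L}| ≤ e^{1/(4β|t|)} exp(-T dist(x,y)/(16|t|))`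
— one-particle correlation length `≤ 16|t|/T`. -/
theorem green_ring_decay (σ σ' : Fin 2) (t U μ β : ℝ) (hβ : 0 ≤ β)
    (hT : (1 : ℝ) ≤ 8 * (β * |t|)) (L : ℕ) [NeZero L] (x y : TorusSite 1 L) :
    ‖(hubbardTorusWith 1 L t U μ).thermalCorr β
        (multiFermionD 1 (fun _ : Fin 1 => (0 : Site 1)) (fun _ => σ) L x)ᴴ
        (multiFermionD 1 (fun _ : Fin 1 => (0 : Site 1)) (fun _ => σ') L y)‖ ≤
      Real.exp (1 / (4 * (β * |t|))) *
        Real.exp (-(1 / (16 * (β * |t|)) * (torusDist x y : ℝ))) := by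
  have h := ringCorrelationLengthLowT_holds 1 (fun _ => 0) (fun _ => 0) (fun _ => σ) (fun _ => σ')
    zeroSteps_mem zeroSteps_mem t U μ β hβ (by exact_mod_cast hT) L x y
  simpa using h

end Summit.HubbardSuperconductivity.HubbardLadder.Bounds

end
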